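import Mathlib
import Summits.Ventures.PercRepro2.LocRows
import Summits.Ventures.PercRepro2.SwRow
import Summits.Ventures.PercRepro2.SwOut
import Summits.Ventures.PercRepro2.SwAllRow
import Summits.Ventures.PercRepro2.SwOutAll
import Summits.Ventures.PercRepro2.SwOutReducible
import Summits.Ventures.PercRepro2.SwOutBlocks
import Summits.Ventures.PercRepro2.SwOutJunctionH1Defs
import Summits.Ventures.PercRepro2.SwOutJunctionH1Key
import Summits.Ventures.PercRepro2.SwOutJunctionH1EdgeThm
import Summits.Ventures.PercRepro2.SwOutJunctionH1BundleDefs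
import Summits.Ventures.PercRepro2.SwOutJunctionH1BundleLift
import Summits.Ventures.PercRepro2.SwOutJunctionH1BundleUniform
import Summits.Ventures.PercRepro2.SwOutJunctionH1BundleHyp

/-!
# THEOREM A WITH ANY EDGES `h–u`: the rigid inequality on every (H1) single-junction class, the
junction joined to `h` by any number of edges (blind cell PercRepro2, night-4 g29, 2026-08-28;
proofs/NIGHT4-G29.md §9)

The bundle version of `SwOutJunctionH1EdgeThm`: g14's Theorem A without `hnadj` at all.  Every edge
`h–u` is subdivided with an outside edge (`bundEnds`); Theorem A applies to `G⁺` verbatim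
(`SwOutJunctionH1BundleHyp`), its block decomposition is summed over the uniform points only
(`card_le_of_blocks_on` of `SwOutJunctionH1EdgeThm` with `buniform_of_mem_blockOf`), and the uniform
points are the uniform lifts of the `Q`-class of `G` with the rigid edge sets pushed along
`b ↦ {h–w_b, w_b–u}` (`card_red_eq_bund`, `card_blue_eq_bund`): **`rigidOK_of_junctionH1_bundle`**;
hence `reducible_of_junctionH1_bundle`, `swAll_of_junctionH1_bundle`, **`sw_of_junctionH1_bundle`**
— rows 2′SW-ALL and (SW) on every graph in which every vertex other than `l, h, o` is joined to `l`
or is one vertex `u ∉ N(l)` whose neighbours other than `h` satisfy (H1), with ANY edges `h–u`.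
The single-edge theorem and Theorem A itself are the cases of one and of no edge `h–u`.
-/

namespace Summit.Ventures.PercRepro2

namespace LocRows

open Hull

variable {V : Type*} {E : Type*} [Fintype E] [DecidableEq E]

open scoped Classical

section Transport

variable {ends : E → Sym2 V} {l h o u : V} {U : Set V}

/-- **The uniform `Q`-class of `G⁺` is the image of the `Q`-class of `G` under the uniform lift**,
with the red edge sets pushed along. -/
lemma filter_buniform_red_eq_image (hl : l ∉ U) (hh : h ∈ U) (ξ : Config E) (𝓔 : Set (Set E)) :
    ((swOutSide (bundEnds ends h u l) (Sum.inl l) (Sum.inl h) (Sum.inl o) (bundRegion U)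
        (blift ξ)).filter fun ζ' => BUniform ζ' ∧
          redEdges (bundEnds ends h u l) ζ' (Sum.inl h) ∈ {F | bundPull F ∈ 𝓔}) =
      ((swOutSide ends l h o U ξ).filter fun ζ => redEdges ends ζ h ∈ 𝓔).image blift := by
  ext ζ'
  simp only [Finset.mem_filter, Finset.mem_image, Set.mem_setOf_eq]
  constructor
  · rintro ⟨hζ', hun, hE⟩
    set ζ := ζ' ∘ Sum.inl with hζdef
    have heq : ζ' = blift ζ := eq_blift_of_buniform hl (mem_swOutSide.1 hζ').2 hun
    rw [heq] at hζ' hE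
    have hζ : ζ ∈ swOutSide ends l h o U ξ := (mem_swOutSide_blift_iff hh).1 hζ'
    refine ⟨ζ, ⟨hζ, ?_⟩, heq.symm⟩
    rwa [redEdges_blift (l_notMem_cluster_of_mem_swOutSide hζ), bundPull_bundPush] at hE
  · rintro ⟨ζ, ⟨hζ, hE⟩, rfl⟩
    refine ⟨(mem_swOutSide_blift_iff hh).2 hζ, buniform_blift ζ, ?_⟩
    rw [redEdges_blift (l_notMem_cluster_of_mem_swOutSide hζ), bundPull_bundPush]
    exact hE

/-- The blue counterpart of `filter_buniform_red_eq_image`. -/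
lemma filter_buniform_blue_eq_image (hl : l ∉ U) (hh : h ∈ U) (ξ : Config E) (𝓔 : Set (Set E)) :
    ((swOutSide (bundEnds ends h u l) (Sum.inl l) (Sum.inl h) (Sum.inl o) (bundRegion U)
        (blift ξ)).filter fun ζ' => BUniform ζ' ∧
          blueEdges (bundEnds ends h u l) ζ' (Sum.inl h) ∈ {F | bundPull F ∈ 𝓔}) =
      ((swOutSide ends l h o U ξ).filter fun ζ => blueEdges ends ζ h ∈ 𝓔).image blift := by
  ext ζ'
  simp only [Finset.mem_filter, Finset.mem_image, Set.mem_setOf_eq]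
  constructor
  · rintro ⟨hζ', hun, hE⟩
    set ζ := ζ' ∘ Sum.inl with hζdef
    have heq : ζ' = blift ζ := eq_blift_of_buniform hl (mem_swOutSide.1 hζ').2 hun
    rw [heq] at hζ' hE
    have hζ : ζ ∈ swOutSide ends l h o U ξ := (mem_swOutSide_blift_iff hh).1 hζ'
    refine ⟨ζ, ⟨hζ, ?_⟩, heq.symm⟩
    rwa [blueEdges_blift (l_notMem_cluster_blue_of_mem_swOutSide hζ), bundPull_bundPush] at hE
  · rintro ⟨ζ, ⟨hζ, hE⟩, rfl⟩
    refine ⟨(mem_swOutSide_blift_iff hh).2 hζ, buniform_blift ζ, ?_⟩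
    rw [blueEdges_blift (l_notMem_cluster_blue_of_mem_swOutSide hζ), bundPull_bundPush]
    exact hE

/-- **The red count transports** to the uniform part of the class of `G⁺`. -/
lemma card_red_eq_bund (hl : l ∉ U) (hh : h ∈ U) (ξ : Config E) (𝓔 : Set (Set E)) :
    ((swOutSide ends l h o U ξ).filter fun ζ => redEdges ends ζ h ∈ 𝓔).card =
      ((swOutSide (bundEnds ends h u l) (Sum.inl l) (Sum.inl h) (Sum.inl o) (bundRegion U)
        (blift ξ)).filter fun ζ' => BUniform ζ' ∧
          redEdges (bundEnds ends h u l) ζ' (Sum.inl h) ∈ {F | bundPull F ∈ 𝓔}).card := by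
  rw [filter_buniform_red_eq_image hl hh ξ 𝓔, Finset.card_image_of_injective _ blift_injective]

/-- **The blue count transports** to the uniform part of the class of `G⁺`. -/
lemma card_blue_eq_bund (hl : l ∉ U) (hh : h ∈ U) (ξ : Config E) (𝓔 : Set (Set E)) :
    ((swOutSide ends l h o U ξ).filter fun ζ => blueEdges ends ζ h ∈ 𝓔).card =
      ((swOutSide (bundEnds ends h u l) (Sum.inl l) (Sum.inl h) (Sum.inl o) (bundRegion U)
        (blift ξ)).filter fun ζ' => BUniform ζ' ∧
          blueEdges (bundEnds ends h u l) ζ' (Sum.inl h) ∈ {F | bundPull F ∈ 𝓔}).card := by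
  rw [filter_buniform_blue_eq_image hl hh ξ 𝓔, Finset.card_image_of_injective _ blift_injective]

end Transport

/-! ## Theorem A with any edges `h–u` -/

section Main

variable {ends : E → Sym2 V} {l h o u : V} {U : Set V}

/-- **THEOREM A WITH ANY EDGES `h–u`**: the rigid inequality on every class of a single-junction
region (no loop at `h` or `u`, every other vertex of `U ∖ {h, o}` with an outside edge or no edge,
the simple-arm hypothesis (H1) for the neighbours of `u`), whatever the edges `h–u`, for every
outside colouring `ξ`. -/
theorem rigidOK_of_junctionH1_bundle (hl : l ∉ U) (hhu : h ≠ u) (hloop_h : ∀ e, ends e ≠ s(h, h))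
    (hloop_u : ∀ e, ends e ≠ s(u, u))
    (hout : ∀ x ∈ U, x ≠ h → x ≠ o → x ≠ u →
      (∃ e y, ends e = s(x, y) ∧ y ∉ U) ∨ (∀ e, x ∉ ends e))
    (hH1 : H1 ends U h u) (ξ : Config E) : RigidOK ends l h o U ξ := by
  intro 𝓔 h𝓔
  by_cases hh : h ∈ U
  swap
  · rw [swOutSide_eq_empty_of_notMem hh]
    simp
  have hl' : (Sum.inl l : V ⊕ Bundle ends h u) ∉ bundRegion U := bund_hl hl
  have hhu' : (Sum.inl h : V ⊕ Bundle ends h u) ≠ Sum.inl u := bund_hhu hhu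
  have hloop_h' : ∀ e, bundEnds ends h u l e ≠ s(Sum.inl h, Sum.inl h) := bund_loop_h hloop_h
  have hloop_u' : ∀ e, bundEnds ends h u l e ≠ s(Sum.inl u, Sum.inl u) := bund_loop_u hloop_u
  have hnadj' : ∀ e, bundEnds ends h u l e ≠ s(Sum.inl h, Sum.inl u) := bund_nadj
  have hout' : ∀ x ∈ bundRegion U, x ≠ Sum.inl h → x ≠ Sum.inl o → x ≠ Sum.inl u →
      (∃ e y, bundEnds ends h u l e = s(x, y) ∧ y ∉ bundRegion U) ∨
        (∀ e, x ∉ bundEnds ends h u l e) := bund_hout hl hout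
  have hH1' : H1 (bundEnds ends h u l) (bundRegion U) (Sum.inl h) (Sum.inl u) :=
    bund_H1 hl hhu hloop_u hH1
  rw [card_red_eq_bund (u := u) hl hh ξ 𝓔, card_blue_eq_bund (u := u) hl hh ξ 𝓔]
  exact card_le_of_blocks_on (blift ξ)
    (keyOf (bundEnds ends h u l) (bundRegion U) (blift ξ) (Sum.inl h) (Sum.inl u))
    (blockOf (bundEnds ends h u l) (Sum.inl h) (Sum.inl u)) BUniform
    (fun _ hζ => mem_blockOf_keyOf hl' hhu' hloop_h' hout' hζ)
    (fun _ hζ _ hζ' hQ =>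
      keyOf_eq_of_mem_blockOf hl' hhu' hloop_h' hloop_u' hnadj' hout' hH1' hζ hζ' hQ)
    (fun _ hζ hun _ hζ' =>
      buniform_of_mem_blockOf hl' hhu hloop_h' hloop_u' hnadj' hout' hH1' hζ hun hζ')
    (fun _ hζ _ h𝓔' => card_blockOf_le hl' hhu' hloop_h' hloop_u' hnadj' hout' hH1' hζ h𝓔')
    (isUpperSet_bundPull_preimage h𝓔)

/-- A region with one (H1) junction, whatever its edges to `h`, is a base region of the series
reduction. -/
theorem reducible_of_junctionH1_bundle (hl : l ∉ U) (hhu : h ≠ u) (hloop_h : ∀ e, ends e ≠ s(h, h))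
    (hloop_u : ∀ e, ends e ≠ s(u, u))
    (hout : ∀ x ∈ U, x ≠ h → x ≠ o → x ≠ u →
      (∃ e y, ends e = s(x, y) ∧ y ∉ U) ∨ (∀ e, x ∉ ends e))
    (hH1 : H1 ends U h u) : Reducible l h o ends U :=
  Reducible.base ends U fun ξ => rigidOK_of_junctionH1_bundle hl hhu hloop_h hloop_u hout hH1 ξ

/-- **Row 2′SW-ALL on every graph with one (H1) junction, whatever its edges to `h`**: every vertex
other than `l, h, o, u` is joined to `l`, `u ≠ l`, no loop at `h` or `u`, and (H1) in `{l}ᶜ`. -/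
theorem swAll_of_junctionH1_bundle (hlh : l ≠ h) (hhu : h ≠ u) (hloop_h : ∀ e, ends e ≠ s(h, h))
    (hloop_u : ∀ e, ends e ≠ s(u, u)) (hH1 : H1 ends ({l}ᶜ) h u)
    (hjoin : ∀ x, x ≠ l → x ≠ h → x ≠ o → x ≠ u → ∃ e, ends e = s(x, l)) : SwAll ends l h o := by
  refine swAll_of_reducible l h o hlh
    (reducible_of_junctionH1_bundle (by simp) hhu hloop_h hloop_u ?_ hH1)
  intro x hx hxh hxo hxu
  obtain ⟨e, he⟩ := hjoin x (by simpa using hx) hxh hxo hxu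
  exact Or.inl ⟨e, l, he, by simp⟩

/-- **Row (SW) on every graph with one (H1) junction, whatever its edges to `h`** (see
`swAll_of_junctionH1_bundle`). -/
theorem sw_of_junctionH1_bundle (hlh : l ≠ h) (hhu : h ≠ u) (hloop_h : ∀ e, ends e ≠ s(h, h))
    (hloop_u : ∀ e, ends e ≠ s(u, u)) (hH1 : H1 ends ({l}ᶜ) h u)
    (hjoin : ∀ x, x ≠ l → x ≠ h → x ≠ o → x ≠ u → ∃ e, ends e = s(x, l)) : Sw ends l h o :=
  sw_of_swAll ends (swAll_of_junctionH1_bundle hlh hhu hloop_h hloop_u hH1 hjoin)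

end Main

end LocRows

end Summit.Ventures.PercRepro2
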